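import Summits.Ventures.PercRepro.Night2OneFatSources

/-!
# PercRepro — the sources of a target with at most one coloop and at least eight points (night-2, gen 29)

`mem_coloops_of_source` (Night2OneFatSources) treats a coloop-free target.  With AT MOST ONE coloop `w` of `S ∖ K` and a
first source `y₀` whose line `R₀` has at least four points, the same argument shows that every other source `y` is a
coloop of `(S ∖ y₀) ∖ K`: the coloops `w′ ≠ w` of `(S ∖ y₀) ∖ K` are no coloops of `(S ∖ y) ∖ K` (`y₀ ∉ cl ((S ∖ y₀ ∖ K) ∖ w′)`,
and `y` lies on the line of the other points of `R₀`), so `(S ∖ y) ∖ K` has a coloop `p ∈ R₀`, against `p ∈ cl (R₀ ∖ {y, p})`.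
Since the coloop `w` of `S ∖ K` is never a source (`(S ∖ w) ∖ K` has rank `4`), a target with one coloop and `≥ 8` points
has at most THREE sources (`C₀ ∖ w` and `y₀`).

* **`mem_coloops_of_source'`**: the second source is a coloop of the first's erasure (at most one coloop, `|R₀| ≥ 4`).
-/

namespace PercRepro.Shadow

open Finset PerFlat ThmH

variable {α : Type*} [DecidableEq α] {M : Matroid α} [M.Finite] {G : Finset α}

section SourcesB

/-- **A second source of a target with at most one coloop lies among the coloops of the first** (`|R₀| ≥ 4`). -/
theorem mem_coloops_of_source' (hG : G ∈ flatsQ M (5 + 1))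
    (hs : ∀ e ∈ gr M, ∀ f ∈ gr M, e ≠ f → rkN M {e, f} = 2) {S : Finset α} (hSG : S ⊆ G)
    (hS5 : rkN M (S \ coloops M G) = 5) (hc : (coloops M (S \ coloops M G)).card ≤ 1) {y₀ y : α} (hy₀ : y₀ ∈ S)
    (hy : y ∈ S) (hne : y ≠ y₀)
    (hQ₀5 : rkN M (S.erase y₀ \ coloops M G) = 5)
    (hC₀ : (coloops M (S.erase y₀ \ coloops M G)).card = 3)
    (hR₀ : rkN M ((S.erase y₀ \ coloops M G) \ coloops M (S.erase y₀ \ coloops M G)) = 2)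
    (hR₀4 : 4 ≤ ((S.erase y₀ \ coloops M G) \ coloops M (S.erase y₀ \ coloops M G)).card)
    (hC : (coloops M (S.erase y \ coloops M G)).card = 3) :
    y ∈ coloops M (S.erase y₀ \ coloops M G) := by
  have hGg : G ⊆ gr M := (mem_flatsQ.1 hG).1
  set V := S \ coloops M G with hV
  have hVg : V ⊆ gr M := Finset.sdiff_subset.trans (hSG.trans hGg)
  -- neither `y₀` nor `y` is the coloop of `G`: erasing it would leave `V` itself, with at most one coloop
  have hy₀K : y₀ ∉ coloops M G := by
    intro h
    have heq : S.erase y₀ \ coloops M G = V := by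
      ext a
      simp only [Finset.mem_sdiff, Finset.mem_erase, hV]
      constructor
      · rintro ⟨⟨-, ha⟩, haK⟩; exact ⟨ha, haK⟩
      · rintro ⟨ha, haK⟩; exact ⟨⟨fun h' => haK (h' ▸ h), ha⟩, haK⟩
    rw [heq] at hC₀
    omega
  have hyK : y ∉ coloops M G := by
    intro h
    have heq : S.erase y \ coloops M G = V := by
      ext a
      simp only [Finset.mem_sdiff, Finset.mem_erase, hV]
      constructor
      · rintro ⟨⟨-, ha⟩, haK⟩; exact ⟨ha, haK⟩
      · rintro ⟨ha, haK⟩; exact ⟨⟨fun h' => haK (h' ▸ h), ha⟩, haK⟩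
    rw [heq] at hC
    omega
  have hy₀V : y₀ ∈ V := Finset.mem_sdiff.2 ⟨hy₀, hy₀K⟩
  have hyV : y ∈ V := Finset.mem_sdiff.2 ⟨hy, hyK⟩
  have hQ₀ : S.erase y₀ \ coloops M G = V.erase y₀ := by
    ext a; simp only [Finset.mem_sdiff, Finset.mem_erase, hV]; tauto
  have hQ : S.erase y \ coloops M G = V.erase y := by
    ext a; simp only [Finset.mem_sdiff, Finset.mem_erase, hV]; tauto
  rw [hQ₀] at hQ₀5 hC₀ hR₀ hR₀4 ⊢
  rw [hQ] at hC
  set Q₀ := V.erase y₀ with hQ₀def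
  set C₀ := coloops M Q₀ with hC₀def
  set R₀ := Q₀ \ C₀ with hR₀def
  have hQ₀g : Q₀ ⊆ gr M := (Finset.erase_subset _ _).trans hVg
  have hC₀Q : C₀ ⊆ Q₀ := fun w hw => (mem_coloops.1 hw).1
  -- (a) `y₀ ∉ cl (Q₀ ∖ w)` for every coloop `w` of `Q₀` that is not a coloop of `V`
  have ha : ∀ w ∈ C₀, w ∉ coloops M V → y₀ ∉ clF M (Q₀.erase w) := by
    intro w hw hwV hcl
    have hwQ : w ∈ Q₀ := hC₀Q hw
    have hwV' : w ∈ V := (Finset.erase_subset _ _) hwQ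
    have hwy₀ : w ≠ y₀ := (Finset.mem_erase.1 hwQ).1
    have h4 : rkN M (Q₀.erase w) = 4 := by
      have := rkN_erase_of_mem_coloops (M := M) hQ₀g hw
      omega
    have h5 : rkN M (insert y₀ (Q₀.erase w)) ≤ 4 := by
      have := rkN_insert_le_of_mem_clF (M := M) ((Finset.erase_subset _ _).trans hQ₀g) hcl
      omega
    have heq : V.erase w = insert y₀ (Q₀.erase w) := by
      ext a
      simp only [Finset.mem_erase, Finset.mem_insert, hQ₀def]
      constructor
      · rintro ⟨haw, haV⟩
        by_cases hay : a = y₀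
        · exact Or.inl hay
        · exact Or.inr ⟨haw, hay, haV⟩
      · rintro (rfl | ⟨haw, -, haV⟩)
        · exact ⟨hwy₀.symm, hy₀V⟩
        · exact ⟨haw, haV⟩
    apply hwV
    rw [mem_coloops]
    refine ⟨hwV', fun hwcl => ?_⟩
    have h6 := rkN_insert_le_of_mem_clF (M := M) ((Finset.erase_subset _ _).trans hVg) hwcl
    rw [Finset.insert_erase hwV', hS5, heq] at h6
    omega
  -- suppose `y ∉ C₀`; then `y ∈ R₀`
  by_contra hyC₀
  have hyQ₀ : y ∈ Q₀ := Finset.mem_erase.2 ⟨hne, hyV⟩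
  have hyR₀ : y ∈ R₀ := Finset.mem_sdiff.2 ⟨hyQ₀, hyC₀⟩
  have hR₀g : R₀ ⊆ gr M := Finset.sdiff_subset.trans hQ₀g
  have hyline : y ∈ clF M (R₀.erase y) := by
    obtain ⟨p, hp, p', hp', hpp'⟩ := Finset.one_lt_card.1 (by
      rw [Finset.card_erase_of_mem hyR₀]; omega : 1 < (R₀.erase y).card)
    have h2 : 2 ≤ rkN M (R₀.erase y) :=
      rkN_pair_eq_two hs ((Finset.erase_subset _ _).trans hR₀g) hp hp' hpp'
    have h2' : rkN M (R₀.erase y) ≤ 2 := by rw [← hR₀]; exact rkN_mono (Finset.erase_subset _ _)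
    exact mem_clF_of_rkN_eq (Finset.erase_subset _ _) hR₀g (by omega) hyR₀
  set Q := V.erase y with hQdef
  have hQg : Q ⊆ gr M := (Finset.erase_subset _ _).trans hVg
  -- (b) a coloop of `Q₀` that is not a coloop of `V` is not a coloop of `Q`
  have hb : ∀ w ∈ C₀, w ∉ coloops M V → w ∉ coloops M Q := by
    intro w hw hwV hwc
    have hwQ₀ : w ∈ Q₀ := hC₀Q hw
    have hwV' : w ∈ V := (Finset.erase_subset _ _) hwQ₀
    have hwy₀ : w ≠ y₀ := (Finset.mem_erase.1 hwQ₀).1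
    have hwy : w ≠ y := fun h => hyC₀ (h ▸ hw)
    have hwQ : w ∈ Q := Finset.mem_erase.2 ⟨hwy, hwV'⟩
    have h4 : rkN M (Q₀.erase w) = 4 := by
      have := rkN_erase_of_mem_coloops (M := M) hQ₀g hw
      omega
    have hyin : y ∈ clF M ((Q₀.erase w).erase y) := by
      refine clF_mono ?_ hyline
      intro a ha
      rw [Finset.mem_erase] at ha ⊢
      rw [Finset.mem_sdiff] at ha
      exact ⟨ha.1, Finset.mem_erase.2 ⟨fun h => ha.2.2 (h ▸ hw), ha.2.1⟩⟩
    have hyQ₀w : y ∈ Q₀.erase w := Finset.mem_erase.2 ⟨hwy.symm, hyQ₀⟩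
    have h4' : rkN M ((Q₀.erase w).erase y) = 4 := by
      have h1 := rkN_insert_le_of_mem_clF (M := M) ((Finset.erase_subset _ _).trans
        ((Finset.erase_subset _ _).trans hQ₀g)) hyin
      rw [Finset.insert_erase hyQ₀w, h4] at h1
      have h2 : rkN M ((Q₀.erase w).erase y) ≤ 4 := by rw [← h4]; exact rkN_mono (Finset.erase_subset _ _)
      omega
    have hy₀n : y₀ ∉ clF M ((Q₀.erase w).erase y) :=
      fun h => ha w hw hwV (clF_mono (Finset.erase_subset _ _) h)
    have h5 := rkN_insert_of_notMem_clF (M := M) (hVg hy₀V) hy₀n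
    rw [h4'] at h5
    have hsub : insert y₀ ((Q₀.erase w).erase y) ⊆ Q.erase w := by
      intro a hha
      rw [Finset.mem_insert] at hha
      rw [Finset.mem_erase, hQdef, Finset.mem_erase]
      rcases hha with rfl | hha
      · exact ⟨hwy₀.symm, hne.symm, hy₀V⟩
      · rw [Finset.mem_erase, Finset.mem_erase, hQ₀def, Finset.mem_erase] at hha
        exact ⟨hha.2.1, hha.1, hha.2.2.2⟩
    have h6 : 5 ≤ rkN M (Q.erase w) := by
      have := rkN_mono (M := M) hsub
      omega
    have h7 : rkN M (Q.erase w) ≤ rkN M Q := rkN_mono (Finset.erase_subset _ _)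
    have h8 : rkN M Q ≤ 5 := by rw [← hS5]; exact rkN_mono (Finset.erase_subset _ _)
    exact notMem_coloops_of_rkN_erase_eq hQg hwQ (by omega) hwc
  -- (c) the coloops of `Q` lie in `coloops V ∪ (R₀ ∖ y) ∪ {y₀}`; at least one of them is in `R₀`
  set C := coloops M Q with hCdef
  have hCsub : C ⊆ (coloops M V) ∪ insert y₀ (R₀.erase y) := by
    intro w hw
    have hwQ : w ∈ Q := (mem_coloops.1 hw).1
    rw [hQdef, Finset.mem_erase] at hwQ
    rw [Finset.mem_union, Finset.mem_insert]
    by_cases hwV : w ∈ coloops M V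
    · exact Or.inl hwV
    · right
      by_cases hwy₀ : w = y₀
      · exact Or.inl hwy₀
      · right
        have hwQ₀ : w ∈ Q₀ := Finset.mem_erase.2 ⟨hwy₀, hwQ.2⟩
        have hwC₀ : w ∉ C₀ := fun h => hb w h hwV hw
        exact Finset.mem_erase.2 ⟨hwQ.1, Finset.mem_sdiff.2 ⟨hwQ₀, hwC₀⟩⟩
  have hCR : 1 ≤ (C ∩ R₀.erase y).card := by
    have h1 : C ⊆ (coloops M V) ∪ insert y₀ (C ∩ R₀.erase y) := by
      intro w hw
      have := hCsub hw
      rw [Finset.mem_union, Finset.mem_insert] at this ⊢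
      rcases this with h | h | h
      · exact Or.inl h
      · exact Or.inr (Or.inl h)
      · exact Or.inr (Or.inr (Finset.mem_inter.2 ⟨hw, h⟩))
    have h2 := Finset.card_le_card h1
    have h3 := Finset.card_union_le (coloops M V) (insert y₀ (C ∩ R₀.erase y))
    have h4 := Finset.card_insert_le y₀ (C ∩ R₀.erase y)
    omega
  obtain ⟨p, hp⟩ := Finset.card_pos.1 hCR
  rw [Finset.mem_inter, Finset.mem_erase] at hp
  have hpR₀ : p ∈ R₀ := hp.2.2
  -- (d) two further points of `R₀` put `p` in the closure of `Q ∖ p`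
  have hex : ∃ p' ∈ R₀, ∃ p'' ∈ R₀, p' ≠ y ∧ p' ≠ p ∧ p'' ≠ y ∧ p'' ≠ p ∧ p' ≠ p'' := by
    have h2 : 2 ≤ ((R₀.erase y).erase p).card := by
      rw [Finset.card_erase_of_mem (Finset.mem_erase.2 ⟨hp.2.1, hpR₀⟩), Finset.card_erase_of_mem hyR₀]
      omega
    obtain ⟨p', hp', p'', hp'', hne'⟩ := Finset.one_lt_card.1 h2
    rw [Finset.mem_erase, Finset.mem_erase] at hp' hp''
    exact ⟨p', hp'.2.2, p'', hp''.2.2, hp'.2.1, hp'.1, hp''.2.1, hp''.1, hne'⟩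
  obtain ⟨p', hp'R₀, p'', hp''R₀, hp'y, hp'p, hp''y, hp''p, hp'p''⟩ := hex
  have hpair : ({p', p''} : Finset α) ⊆ R₀ := by
    intro a hha
    rw [Finset.mem_insert, Finset.mem_singleton] at hha
    rcases hha with rfl | rfl
    · exact hp'R₀
    · exact hp''R₀
  have hr2 : rkN M ({p', p''} : Finset α) = 2 := hs p' (hR₀g hp'R₀) p'' (hR₀g hp''R₀) hp'p''
  have hpcl : p ∈ clF M ({p', p''} : Finset α) :=
    mem_clF_of_rkN_eq hpair hR₀g (by rw [hr2, hR₀]) hpR₀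
  have hQmem : ∀ a ∈ R₀, a ≠ y → a ∈ Q := fun a ha hay =>
    Finset.mem_erase.2 ⟨hay, (Finset.erase_subset _ _) (Finset.sdiff_subset ha)⟩
  have hsub : ({p', p''} : Finset α) ⊆ Q.erase p := by
    intro a hha
    rw [Finset.mem_insert, Finset.mem_singleton] at hha
    rcases hha with rfl | rfl
    · exact Finset.mem_erase.2 ⟨hp'p, hQmem _ hp'R₀ hp'y⟩
    · exact Finset.mem_erase.2 ⟨hp''p, hQmem _ hp''R₀ hp''y⟩
  exact (mem_coloops.1 hp.1).2 (clF_mono hsub hpcl)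

end SourcesB

end PercRepro.Shadow
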